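import Summits.HodgeConjecture.HodgeConjecture.Theorems.H413TowerRealisationGlue
import Summits.HodgeConjecture.HodgeConjecture.Theorems.H413SpectrumInterfaces
import Summits.HodgeConjecture.CorCM.Hyp413.A3Liu413FaceTypes
import Literature.RepresentationTheory.Semisimple.EquivariantIrreducibleDecomposition
import HarnessLib

/-!
# FLOOR-0 P2 — stub U1′ `stub_U1_realisationAt` AT THE PIN: the injective `U(V)(𝔸_{F⁺,f})`-equivariant Matsushima–Hodge realisation of the pin's
# `H¹_{B,τ'}(A_∞, ℂ)` in the `(1,0) ⊕ (0,1)` cotangent automorphic forms of the factor of record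

Cell hodgecm-mathlib (D-0151), FLOOR 0, crux item H413 = stmt-HodgeConjecture-24833; programme P2, line of record
`Cruxes/H413/Lines/P2ThetaDictionaryExists.lean` (A-p18 (g15) v3 8c6e58a8), registered stub **U1′ `stub_U1_realisationAt : StubU1RealisationAt`** (:344 ∕ :407).
Author F0P2-p04 (g0) (wave 2, seat U1′; joint desk with P3-S1 = F0P3-p01 (g0) and P4-T2′).  `--supports stmt-HodgeConjecture-24833 --as helper`.
HC_CM is proved only modulo the 7 printed citations until rung 0 closes; this file proves nothing about them.

THE STATEMENT, restated token for token from the line with the Lines-local abbreviation `RealisedIn` UNFOLDED (a `Theorems/` file may not import a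
`Cruxes/…/Lines/` module; `RealisedIn P τ' R A := ∃ r : P.HB τ' →ₗ[ℂ] X, Injective r ∧ (∀ x, r x ∈ A) ∧ ∀ g x, r (P.rhoB τ' g x) = R g (r x)`): for every
face `P = datum413 hDel F V a₀ Φ i` with `P.n = 3` and every `τ'` there is an INJECTIVE `ℂ`-linear map `r : P.HB τ' → (U(V)(𝔸_{F⁺}) → ℂ²)` with values in
`cohForms (archFactorOf F V)`, intertwining the pin's Hecke action `P.rhoB τ'` with the finite-adelic right translation `rightRep F V` (`u1RealisationAt`);
and BY NAME over the shared interfaces module ★ `Theorems/H413SpectrumInterfaces` (F0P2-plan (g0), couriered by A-p18 (g15)), whose `StubU1RealisationAt` ∕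
`RealisedIn` are the line's v3 text verbatim: **`stubU1RealisationAt_holds : SpectrumInterfaces.StubU1RealisationAt`**.  The line's own fold is then
`theorem stub_U1_realisationAt : StubU1RealisationAt := TowerRealisation.stubU1RealisationAt_holds` (same body, `RealisedIn` unfolds by `Iff.rfl`).

THE PROOF: the pin's `HB τ'` IS binder-1's tower `Tower … V` at the universe records of record (`datum413` ∘ `prop413Data` ∘ `liuDictionaryPin` ∘
`LiuDictionary.ofTower`, all `rfl`) and `rhoB τ' = Representation.ofModule'` acts by `MonoidAlgebra.of ℂ _ g • · = act g` (★ `ofModule'_apply_eq_of_smul`,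
★ `TowerAlgebra.of_smul_eq_act`) — exactly as in ★ `Theorems/H413CuspCotPin` for the opposite direction; the map is ★ `TowerRealisation.exists_realisation`
(`Theorems/H413TowerRealisationGlue`: the direct limit over the levels of `glue (π c) + conj (glue (π (conj c)))`, F0P3-p01's ★ `F0P3TowerGlue` assembled by
★ `H413TowerRealisation`); the regime hypothesis `IsAnisotropic` holds because `6 ≤ [F:ℚ]` (★ `HermSpace3.isAnisotropic`).  The hypothesis `P.n = 3` is not used.
[cite: BorelWallach2000, VII 3.2, VII 3.6, XIII 1.2] [cite: VoisinHodgeI2002, §6.1.3 Prop. 6.11, Cor. 7.6] [cite: Borel1997, §5.14] [cite: Liu2021, proof of Prop. 4.13, l. 2121–2131]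

## References
* [BorelWallach2000] A. Borel, N. Wallach, 2nd ed., AMS 2000, VII 3.2 ∕ 3.6 (Matsushima, Hodge bigrading), XIII 1.2 (adelic pieces).
* [VoisinHodgeI2002] C. Voisin, CUP 2002, §6.1.3 Prop. 6.11 (`H¹ = H^{1,0} ⊕ H^{0,1}`), §7.1.1 Cor. 7.6.  * [Borel1997] A. Borel, §5.14.
* [Liu2021] Y. Liu, Camb. J. Math. 9 (2021), proof of Prop. 4.13 (l. 2121–2131: the Matsushima step).
* Tree: ★ `Theorems/H413TowerRealisationGlue` (`exists_realisation`), ★ `Theorems/H413SpectrumInterfaces` (`StubU1RealisationAt`, `RealisedIn`), `CorCM/Hyp413/A3Liu413FaceTypes` (`datum413`), HodgeCM `Model/TowerAlgebra`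
  (`of_smul_eq_act`), `Literature/RepresentationTheory/Semisimple/EquivariantIrreducibleDecomposition` (`ofModule'_apply_eq_of_smul`), ★ `Theorems/H413CuspCotPin` (template).
-/

set_option autoImplicit false
set_option linter.dupNamespace false

noncomputable section

open MulAction NumberField NumberField.InfinitePlace
open HodgeCM HodgeCM.Model HodgeCM.Model.LiuIndex HodgeCM.Model.TowerCarrier
open Summit.HodgeConjecture.CorCM.Model
open Literature.AlgebraicGeometry.Motives (CMType)
open Literature.AlgebraicGeometry.HodgeTheory Literature.NumberTheory.Automorphic.PicardCM
open Literature.AlgebraicGeometry.ShimuraVarieties Literature.AlgebraicGeometry.ShimuraVarieties.UnitaryCanonicalModel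
open Literature.NumberTheory.ComplexMultiplication
open Literature.NumberTheory.Automorphic
open Literature.NumberTheory.Automorphic.Liu2021 Literature.NumberTheory.Automorphic.Liu2021.AppendixC
open Literature.NumberTheory.GelbartRogawski1991
open Summit.HodgeConjecture.CorCM Summit.HodgeConjecture.CorCM.Transposition
open Summit.HodgeConjecture.CorCM.Lines.A3Liu413 (datum413)
open Summit.HodgeConjecture.HodgeConjecture.Cruxes.H413.CohFormsCarriers

namespace Summit.HodgeConjecture.HodgeConjecture.Cruxes.H413.TowerRealisation

set_option synthInstance.maxHeartbeats 400000 in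
set_option maxHeartbeats 8000000 in
/-- **U1′ AT THE PIN, PROVED — the body of `StubU1RealisationAt` (P2 line `P2ThetaDictionaryExists`, A-p18 (g15)) with `RealisedIn` unfolded**: for every
face and every `τ'` (and vacuously in the hypothesis `n = 3`) there is an INJECTIVE `ℂ`-linear realisation `r : H¹_{B,τ'}(A_∞, ℂ) → (U(V)(𝔸_{F⁺}) → ℂ²)`
of the pin's tower by `(1,0) ⊕ (0,1)` cotangent automorphic forms of the factor of record `archFactorOf F V`, intertwining `rhoB τ'` with `rightRep F V`.
[cite: BorelWallach2000, VII 3.2, VII 3.6, XIII 1.2] [cite: VoisinHodgeI2002, §6.1.3 Prop. 6.11, Cor. 7.6] [cite: Borel1997, §5.14]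
[cite: Liu2021, proof of Prop. 4.13, l. 2121–2131] -/
theorem u1RealisationAt :
    ∀ (hDel : Literature.AlgebraicGeometry.ShimuraVarieties.UnitaryCanonicalModel.canonicalModel_exists_printed)
      (F : HodgeCM.CMField) [IsGalois ℚ F] (h6 : 6 ≤ Module.finrank ℚ F) {ι₁ : F →+* ℂ} (V : HodgeCM.HermSpace3 F ι₁) (a₀ : RealScalar F)
      (Φ : CMType F) (hΦ : ι₁ ∈ Φ.1) (i : (I V (repAt a₀) (muLiu ι₁ GramClass.rep))),
      (datum413 hDel F V a₀ Φ i).n = 3 → ∀ τ' : HodgeCM.CMField.K F →+* ℂ,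
        ∃ r : (datum413 hDel F V a₀ Φ i).HB τ' →ₗ[ℂ] ((adelicDatum F V).Adelic → (Fin 2 → ℂ)),
          Function.Injective r ∧ (∀ x, r x ∈ cohForms (archFactorOf F V)) ∧
            ∀ (g : ↥(HodgeCM.HermSpace3.adelicFin V)) (x : (datum413 hDel F V a₀ Φ i).HB τ'),
              r ((datum413 hDel F V a₀ Φ i).rhoB τ' g x) = rightRep F V g (r x) := by
  intro hDel F _ h6 ι₁ V a₀ Φ _ i _ τ'
  have h4 : 4 ≤ Module.finrank ℚ F := le_trans (by norm_num) h6
  have hV : IsAnisotropic F (HodgeCM.HermSpace3.Hm V) := HodgeCM.HermSpace3.isAnisotropic V h4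
  obtain ⟨r, hinj, hmem, hact⟩ := exists_realisation exists_isReal_hodgeModel_holds hodgePQ_independent_of_hodgeModel_holds
    Summit.HodgeConjecture.CorCM.BallQuotient.ballQuotientUniformised_holds
    (cmAbelianVarietyRealised_of_eigenbasis exists_isReal_hodgeModel_holds hodgePQ_independent_of_hodgeModel_holds
      Summit.HodgeConjecture.CorCM.cmAbelianVarietyEigenbasisRealised_holds)
    Literature.NumberTheory.Transcendental.arapura2012_cor_15_4_6_holds (V := V) hV
  refine ⟨r, hinj, hmem, fun g x => ?_⟩
  -- the pin's `rhoB τ' = Representation.ofModule'` acts on the tower by `of g • · = act g = towerRep g`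
  have h2 : (datum413 hDel F V a₀ Φ i).rhoB τ' g x =
      towerRep exists_isReal_hodgeModel_holds hodgePQ_independent_of_hodgeModel_holds
        (ballQuotientUniformisedDatum_of Summit.HodgeConjecture.CorCM.BallQuotient.ballQuotientUniformised_holds)
        (cmAbelianVarietyRealised_of_eigenbasis exists_isReal_hodgeModel_holds hodgePQ_independent_of_hodgeModel_holds
          Summit.HodgeConjecture.CorCM.cmAbelianVarietyEigenbasisRealised_holds)
        Literature.NumberTheory.Transcendental.arapura2012_cor_15_4_6_holds V g x :=
    (Literature.RepresentationTheory.Semisimple.ofModule'_apply_eq_of_smul (k := ℂ) (G := ↥(HodgeCM.HermSpace3.adelicFin V))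
        (Tower exists_isReal_hodgeModel_holds hodgePQ_independent_of_hodgeModel_holds
          (ballQuotientUniformisedDatum_of Summit.HodgeConjecture.CorCM.BallQuotient.ballQuotientUniformised_holds)
          (cmAbelianVarietyRealised_of_eigenbasis exists_isReal_hodgeModel_holds hodgePQ_independent_of_hodgeModel_holds
            Summit.HodgeConjecture.CorCM.cmAbelianVarietyEigenbasisRealised_holds)
          Literature.NumberTheory.Transcendental.arapura2012_cor_15_4_6_holds V) g x).trans
      (of_smul_eq_act _ _ _ _ _ g x)
  rw [h2]
  exact hact g x

set_option synthInstance.maxHeartbeats 400000 in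
set_option maxHeartbeats 8000000 in
/-- **U1′ BY NAME**: the P2 line's stub type `StubU1RealisationAt` as typed in the shared interfaces module ★ `Theorems/H413SpectrumInterfaces` (v3 text verbatim,
`RealisedIn` included), PROVED — `exact u1RealisationAt` binder for binder. [cite: BorelWallach2000, VII 3.2, VII 3.6, XIII 1.2] [cite: VoisinHodgeI2002, §6.1.3 Prop. 6.11, Cor. 7.6]
[cite: Liu2021, proof of Prop. 4.13, l. 2121–2131] -/
theorem stubU1RealisationAt_holds : SpectrumInterfaces.StubU1RealisationAt :=
  fun hDel F _ h6 _ V a₀ Φ hΦ i hn τ' => u1RealisationAt hDel F h6 V a₀ Φ hΦ i hn τ'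

end Summit.HodgeConjecture.HodgeConjecture.Cruxes.H413.TowerRealisation

end
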